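import Summits.HubbardSuperconductivity.HubbardSuperconductivity.Theorems.AnisotropyChordTransferFibre3FinMHoleL15a
import Summits.HubbardSuperconductivity.HubbardSuperconductivity.Theorems.AnisotropyChordTransferFibre3FinMHoleL15b
import Summits.HubbardSuperconductivity.HubbardSuperconductivity.Theorems.AnisotropyChordTransferFibre3FinMHoleL15c
import Summits.HubbardSuperconductivity.HubbardSuperconductivity.Theorems.AnisotropyChordTransferFibre3FinMHoleL15d
import Summits.HubbardSuperconductivity.HubbardSuperconductivity.Theorems.AnisotropyChordTransferFibre3FinMHoleL15e

/-!
# Route `AnisotropyChord` / H0 rotor rung: ★ the regime clause `mHole ≥ 0` at `L = 15` for EVERY ground profile (FIN-class, kernel-certified)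

`mHole_nonneg_fifteen`: for every `0 < Δ < 1` and every ground two-magnon profile `f` at `L = 15`, `0 ≤ mHole 15 Δ f`, i.e.
`T⁺ ≤ ε₁(1 − 5/V + 6/V²)/2` — the first half of the regime clause of the GM₃ assembly `gm3_allL` at this `L`, by the FIN
evaluator in convolution form (`…FinConvCell`; soundness `…FinRCCell.mHole_nonneg_of_cells4`; kernel facts `…FinMHoleL15*`).
Prover seat `hubbard-h0-rotor-p3` g4; helper for stmt-HubbardSuperconductivity-23918 (piece A of rung 19089; `--supports`, helper class).
WHAT THIS IS NOT: nothing here proves superconductivity in the Hubbard model (rotor TARGET as worded stays FALSE, g15 verdict); one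
hypothesis of ONE conditional reduction at one `L`; the three β-free cruxes and the side condition remain. Tree imports only; no sorry.
-/

set_option linter.dupNamespace false
set_option autoImplicit false

namespace Summit.HubbardSuperconductivity.HubbardSuperconductivity.Theorems.AnisotropyChord.Transfer.Fibre3

namespace FinCell

/-- the cell list at `L = 15` (15 points in units of `2^60`, from `0` to `≥ lamTop 15`) passes cellwise. [folklore] -/
theorem cellsAll_fifteen : cellsAll (mholeCellOK4 15) [0, 496624958488114, 1291224892069096, 2562584785798666, 4596760615765980, 6224101279739831, 7525973810918912, 8567471835862177, 10233868675771400, 11566986147698778, 13699974102782584, 17112754830916674, 18488876585220608, 19176937462372576, 19864998339524544] = true := by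
  simp only [cellsAll, cell15_1, cell15_2, cell15_3, cell15_4, cell15_5, cell15_6, cell15_7, cell15_8, cell15_9, cell15_10, cell15_11, cell15_12, cell15_13, cell15_14, Bool.true_and]

/-- kernel fact: the cell list at `L = 15` is a certificate (`mholeCheck4`): head `0`, length, `lamTop 15 ≤` last point, all cells. [folklore] -/
theorem mholeCheck4_fifteen : mholeCheck4 15 [0, 496624958488114, 1291224892069096, 2562584785798666, 4596760615765980, 6224101279739831, 7525973810918912, 8567471835862177, 10233868675771400, 11566986147698778, 13699974102782584, 17112754830916674, 18488876585220608, 19176937462372576, 19864998339524544] = true := by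
  unfold mholeCheck4
  rw [cellsAll_fifteen]
  decide +kernel

end FinCell

/-- ★★ THE REGIME CLAUSE `mHole ≥ 0` AT `L = 15`: every ground two-magnon profile at `L = 15`, `0 < Δ < 1`, has
`T⁺ ≤ ε₁(1 − 5/V + 6/V²)/2` (FIN-class, kernel-certified with zero data). [folklore] -/
theorem mHole_nonneg_fifteen {Δ : ℝ} (hΔ0 : 0 < Δ) (hΔ1 : Δ < 1) :
    ∀ lam2 : ℝ, ∀ f : Tor 15 → ℝ, IsGroundTwoMagnon 15 Δ lam2 f → 0 ≤ mHole 15 Δ f :=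
  FinCell.mHole_nonneg_of_cells4 15 (by norm_num) [0, 496624958488114, 1291224892069096, 2562584785798666, 4596760615765980, 6224101279739831, 7525973810918912, 8567471835862177, 10233868675771400, 11566986147698778, 13699974102782584, 17112754830916674, 18488876585220608, 19176937462372576, 19864998339524544] FinCell.mholeCheck4_fifteen hΔ0 hΔ1

end Summit.HubbardSuperconductivity.HubbardSuperconductivity.Theorems.AnisotropyChord.Transfer.Fibre3
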